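import Summits.QuantumFields.YangMills.Theses.IsotropyFromPowerCounting
import Summits.QuantumFields.YangMills.Theorems.LangevinControlUVOSLegsFromFemtoAndGapStubAssemblyLowDegree
import Summits.QuantumFields.YangMills.Theorems.PencilRigidityNPointIsotropyRiemannSum

/-!
# `TemperedCurvatureMoments` (T, stmt-QuantumFields-17721) reduced to the Wilson lattice moments;
# T for every scheme with bounded multiplicative renormalisation of the curvature species

Support file for the item `IsotropyFromPowerCounting.TemperedCurvatureMoments` (T) — the shared Yang–Mills
input `stub_temperedLatticeApproximants` of the crux lines of stmt-9663 / 11686 / 14999 (line `Sketch` of crux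
`MirrorModularBoosts.SoftKernelBoostCovariance`, lead c5).

T asks, for a tied one-species family `S₁` (`W1 r sch S₁`), for lattice densities `D_k` that are TEMPERED at
injective multi-sites uniformly in `k ≥ k₀` and whose Riemann sums `(a_k⁴)ⁿ Σₓ ∏ᵢ fᵢ(a_k xᵢ) D_k(x)` converge to
`S₁ n` on off-diagonal real tensors.  The intended witness is the TRUE renormalised moment density of Wilson's
lattice theory,
  `D_k(x) = c_kⁿ · W_k(x)`, `W_k(x) = ∫ ∏ᵢ (F(τ_{xᵢ} Ũ) − m_k) dμ_{β_k, 2L_k+1}(U)` (`torusMoment`),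
`F` the Wilson action density of `r`, `c_k = sch.c r.curvature k`, `m_k = sch.m r.curvature k`.  This file
certifies that witness against the tree's `latticeSchwinger` and isolates the content of T:

* `riemannSum_trueDensity_eq_latticeSchwinger` — with `D_k = c_kⁿ W_k` the Riemann sum of T IS the lattice
  `n`-point function of the tie (the algebra is the landed toolkit lemma `latticeSchwinger_eq_latticeDist`);
* `temperedCurvatureMoments_of_trueDensity_tempered` — hence T at `(r, sch, S₁, n)` follows from the tie alone as
  soon as the true densities `c_kⁿ W_k` are tempered: T is EXACTLY a statement about Wilson lattice moments of the
  curvature species along the scheme (no `S₁`, no OS data) — the form a Yang–Mills proof must target;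
* `latticeSchwinger_one_eq` — the degree-one lattice function is `c_k (⟨F⟩_k − m_k) · a_k⁴ Σ_y f(a_k y)`
  (`⟨F⟩_k` the torus Wilson mean, translation invariance of Wilson's measure);
* `eventually_abs_renormalisedMean_le` — the tie at degree one against ONE bump of non-zero integral forces the
  renormalised mean `κ_k = c_k (⟨F⟩_k − m_k)` to converge, hence to stay bounded (Riemann sums of a Schwartz
  function over the exploding fine boxes converge to its integral);
* `temperedCurvatureMoments_of_bddRenormalisation` — T with ONE extra hypothesis, bounded MULTIPLICATIVE
  renormalisation of the curvature species (`|c_k| ≤ B`): then `|D_k| ≤ (2 B M + K)ⁿ` eventually (`M` a bound of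
  the action density, `K` of `κ_k`), so T holds with `N = 0`.  This covers every certified inhabitant of `W1`
  (`c ≡ 0` schemes, `β ≡ 0` / strong coupling with bounded `c`) and puts the whole content of the item T in the
  physical regime `|c_k| → ∞` (`c_k ≍ a_k⁻⁴` for `tr F²`).

References: Jaffe–Witten 2000 §6 (lattice approximation); Glimm–Jaffe 1987 §6.1; Osterwalder–Schrader 1973 §2.
-/

noncomputable section

open scoped SchwartzMap BigOperators
open MeasureTheory Filter Topology
open Literature.MathematicalPhysics.QuantumFieldTheory Literature.MathematicalPhysics.QuantumLattice
open Literature.MathematicalPhysics.AQFT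
open Literature.Probability.LatticeModels (box Site)
open Summit.QuantumFields.YangMills.Theorems.OSLegsFromFemtoAndGap
  (torusMoment latticeDist latticeDist_apply latticeSchwinger_eq_latticeDist abs_torusMoment_le_pow
    abs_wilsonTorusMean_le integrable_dens_lift torusE_dens_eq_wilsonTorusMean)
open Summit.QuantumFields.YangMills.Cruxes.OSLegsFromFemtoAndGap.DlrCollarTransfer (torusE dens)
open Summit.QuantumFields.YangMills.Theorems.NPointIsotropy.ComplexRotationBandlimit (tendsto_riemannSum_box)
open Summit.QuantumFields.YangMills.Theorems.CurvatureBoostCovariance.Negative (Tie W1 EightFrameRP PlanarCone)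
open Summit.QuantumFields.YangMills.Theorems.NPointIsotropy.Negative (E4)

namespace Summit.QuantumFields.YangMills.Theorems.SoftKernelBoostCovariance.Sketch

variable {G : Type} [Group G] [TopologicalSpace G] [IsTopologicalGroup G] [CompactSpace G]
  [MeasurableSpace G] [BorelSpace G]

/-! ## The true density: its Riemann sums are the lattice `n`-point functions -/

/-- **The Riemann sum of the true renormalised density is the lattice `n`-point function.**  For every scheme,
step `k`, degree `n`, real test functions `f` and tensor witness `F = ⊗ᵢ fᵢ`:
`(a_k⁴)ⁿ Σ_{x ∈ boxⁿ} (∏ᵢ fᵢ(a_k xᵢ)) · c_kⁿ W_k(x) = latticeSchwinger r.ρ sch (·.F) k n (curvature,…) f` (in `ℂ`). -/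
theorem riemannSum_trueDensity_eq_latticeSchwinger (r : LatticeRep G) (sch : SpeciesScheme (YMSpecies G))
    (k n : ℕ) (f : Fin n → 𝓢(E4, ℝ)) (F : 𝓢((Fin n → E4), ℂ))
    (hF : IsTensorOf F (fun i => ofRealTest (f i))) :
    ((((sch.a k ^ 4) ^ n *
        ∑ x ∈ Fintype.piFinset (fun _ : Fin n => box 4 (sch.L k)),
          (∏ i, f i (sch.a k • siteToE (x i))) *
            ((sch.c r.curvature k) ^ n *
              torusMoment r.ρ (sch.β k) (sch.L k) r.curvature.F (sch.m r.curvature k) x) : ℝ) : ℂ)) =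
      ((latticeSchwinger r.ρ sch (fun s => s.F) k n (fun _ => r.curvature) f : ℝ) : ℂ) := by
  classical
  rw [latticeSchwinger_eq_latticeDist r sch r.curvature k n f F hF, latticeDist_apply]
  push_cast
  simp only [Finset.mul_sum]
  refine Finset.sum_congr rfl fun x _ => ?_
  have hFx : F (fun i => sch.a k • siteToE (x i)) = ∏ i, ((f i (sch.a k • siteToE (x i)) : ℝ) : ℂ) := by
    rw [hF]
    simp [ofRealTest_apply]
  rw [hFx]
  ring

/-- **T from tempered TRUE densities (pointwise in `(r, sch, S₁, n)`).**  If `S₁` is tied to the scheme (first clause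
of `W1`) and the true renormalised moment densities `c_kⁿ W_k` of degree `n` are tempered at injective multi-sites
uniformly in `k ≥ k₀`, then the degree-`n` conclusion of `TemperedCurvatureMoments` holds at `(r, sch, S₁)`, with
`D_k := c_kⁿ W_k` as the witness.  So the item T is exactly the temperedness of Wilson lattice moments. -/
theorem temperedCurvatureMoments_of_trueDensity_tempered (r : LatticeRep G) (sch : SpeciesScheme (YMSpecies G))
    (S₁ : SchwingerFamily E4) (htie : Tie r sch S₁) {n : ℕ} (hn : 0 < n)
    (hD : ∃ (C : ℝ) (N k₀ : ℕ), 0 < C ∧ ∀ k : ℕ, k₀ ≤ k → ∀ x : Fin n → Site 4,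
      (∀ i, x i ∈ box 4 (sch.L k)) → Function.Injective x →
        |(sch.c r.curvature k) ^ n * torusMoment r.ρ (sch.β k) (sch.L k) r.curvature.F (sch.m r.curvature k) x| ≤
          C * (1 + ‖fun i => sch.a k • siteToE (x i)‖) ^ N *
            (1 + ∑ i, ∑ j ∈ Finset.univ.erase i,
              ‖sch.a k • siteToE (x i) - sch.a k • siteToE (x j)‖⁻¹) ^ N) :
    ∃ (D : ℕ → (Fin n → Site 4) → ℝ) (C : ℝ) (N k₀ : ℕ), 0 < C ∧
      (∀ k : ℕ, k₀ ≤ k → ∀ x : Fin n → Site 4, (∀ i, x i ∈ box 4 (sch.L k)) → Function.Injective x →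
        |D k x| ≤ C * (1 + ‖fun i => sch.a k • siteToE (x i)‖) ^ N *
          (1 + ∑ i, ∑ j ∈ Finset.univ.erase i,
            ‖sch.a k • siteToE (x i) - sch.a k • siteToE (x j)‖⁻¹) ^ N) ∧
      ∀ (f : Fin n → SchwartzMap E4 ℝ) (F : SchwartzMap (Fin n → E4) ℂ),
        IsTensorOf F (fun i => ofRealTest (f i)) → IsOffDiagonal F →
        Filter.Tendsto (fun k => (((sch.a k ^ 4) ^ n *
          ∑ x ∈ Fintype.piFinset (fun _ : Fin n => box 4 (sch.L k)),
            (∏ i, f i (sch.a k • siteToE (x i))) * D k x : ℝ) : ℂ)) Filter.atTop (nhds (S₁ n F)) := by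
  obtain ⟨C, N, k₀, hC, hbd⟩ := hD
  refine ⟨fun k x => (sch.c r.curvature k) ^ n *
      torusMoment r.ρ (sch.β k) (sch.L k) r.curvature.F (sch.m r.curvature k) x, C, N, k₀, hC, hbd, ?_⟩
  intro f F hF hF'
  have h := htie n (Nat.pos_iff_ne_zero.mp hn) f F hF hF'
  refine h.congr fun k => ?_
  exact (riemannSum_trueDensity_eq_latticeSchwinger r sch k n f F hF).symm

/-! ## Degree one: the renormalised mean `κ_k = c_k (⟨F⟩_k − m_k)` is bounded along any tied scheme -/

/-- **The degree-one lattice function, exactly**: for one real test function `f`,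
`latticeSchwinger … k 1 (curvature) (f) = c_k (⟨F⟩_k − m_k) · (a_k⁴ Σ_{y ∈ box} f(a_k y))`, `⟨F⟩_k` the torus Wilson
mean of the action density (independent of the site by translation invariance of Wilson's measure). -/
theorem latticeSchwinger_one_eq (r : LatticeRep G) (sch : SpeciesScheme (YMSpecies G)) (k : ℕ) (f : 𝓢(E4, ℝ)) :
    latticeSchwinger r.ρ sch (fun s => s.F) k 1 (fun _ => r.curvature) (fun _ => f) =
      sch.c r.curvature k *
        (wilsonTorusMean r.ρ (sch.β k) (sch.L k) r.curvature.F - sch.m r.curvature k) *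
        (sch.a k ^ 4 * ∑ y ∈ box 4 (sch.L k), f (sch.a k • siteToE y)) := by
  classical
  set β := sch.β k
  set L := sch.L k
  set m := sch.m r.curvature k
  have hiD : ∀ y : Site 4, Integrable (fun U : GaugeConfig 4 (2 * L + 1) G =>
      r.curvature.F (configShift (-y) (torusLift (2 * L + 1) U)))
      (wilsonMeasure (d := 4) (L := 2 * L + 1) r.ρ β) := fun y => integrable_dens_lift r β L y
  haveI := isProbabilityMeasure_wilsonMeasure (d := 4) (L := 2 * L + 1) r.ρ r.continuous β
  have hmean : ∀ y : Site 4, (∫ U : GaugeConfig 4 (2 * L + 1) G,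
      (r.curvature.F (configShift (-y) (torusLift (2 * L + 1) U)) - m)
        ∂(wilsonMeasure (d := 4) (L := 2 * L + 1) r.ρ β)) =
      wilsonTorusMean r.ρ β L r.curvature.F - m := fun y => by
    rw [integral_sub (hiD y) (integrable_const _), integral_const]
    have h := torusE_dens_eq_wilsonTorusMean (G := G) r β L y
    simp only [torusE, dens] at h
    simp [h]
  have hI : ∀ y : Site 4, Integrable (fun U : GaugeConfig 4 (2 * L + 1) G =>
      f (sch.a k • siteToE y) * (r.curvature.F (configShift (-y) (torusLift (2 * L + 1) U)) - m))
      (wilsonMeasure (d := 4) (L := 2 * L + 1) r.ρ β) :=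
    fun y => ((hiD y).sub (integrable_const m)).const_mul _
  unfold latticeSchwinger
  simp only [Fin.prod_univ_one]
  show (∫ U : GaugeConfig 4 (2 * L + 1) G, smearedLatticeField r.curvature.F (box 4 L) (sch.a k)
      (sch.c r.curvature k) m f (torusLift (2 * L + 1) U) ∂(wilsonMeasure (d := 4) (L := 2 * L + 1) r.ρ β)) = _
  simp only [smearedLatticeField]
  rw [integral_const_mul, integral_finsetSum _ (fun y _ => hI y)]
  simp only [integral_const_mul, hmean]
  rw [← Finset.sum_mul]
  ring

/-- A real bump on `ℝ⁴` with non-zero integral, as a Schwartz function. -/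
theorem exists_schwartz_integral_ne_zero : ∃ g : 𝓢(E4, ℝ), (∫ x, g x) ≠ 0 := by
  let b : ContDiffBump (0 : E4) := ⟨1, 2, one_pos, one_lt_two⟩
  refine ⟨b.hasCompactSupport.toSchwartzMap b.contDiff, ?_⟩
  have h : (∫ x, (b.hasCompactSupport.toSchwartzMap b.contDiff) x) = ∫ x, b x := rfl
  rw [h]
  exact (b.integral_pos).ne'

/-- **The renormalised mean is eventually bounded along a tied scheme.**  If `S₁` is tied to `(r, sch)` then
`κ_k = c_k (⟨F⟩_k − m_k)` converges (test the degree-one tie against one bump `g` with `∫ g ≠ 0`: the lattice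
one-point function is `κ_k · a_k⁴ Σ g(a_k y)` and the Riemann sums tend to `∫ g`), hence `|κ_k| ≤ K` for `k ≥ k₁`. -/
theorem eventually_abs_renormalisedMean_le (r : LatticeRep G) (sch : SpeciesScheme (YMSpecies G))
    (S₁ : SchwingerFamily E4) (htie : Tie r sch S₁) :
    ∃ K : ℝ, ∀ᶠ k in atTop,
      |sch.c r.curvature k * (wilsonTorusMean r.ρ (sch.β k) (sch.L k) r.curvature.F - sch.m r.curvature k)| ≤ K := by
  obtain ⟨g, hg⟩ := exists_schwartz_integral_ne_zero
  obtain ⟨F, hF⟩ := exists_isTensorOf (fun _ : Fin 1 => ofRealTest g)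
  -- the three sequences
  set κ : ℕ → ℝ := fun k =>
    sch.c r.curvature k * (wilsonTorusMean r.ρ (sch.β k) (sch.L k) r.curvature.F - sch.m r.curvature k) with hκ
  set R : ℕ → ℝ := fun k => sch.a k ^ 4 * ∑ y ∈ box 4 (sch.L k), g (sch.a k • siteToE y) with hR
  have hRlim : Tendsto R atTop (𝓝 (∫ x, g x)) :=
    tendsto_riemannSum_box g sch.a sch.L sch.a_pos sch.tendsto_a sch.tendsto_L
  have hRlimC : Tendsto (fun k => ((R k : ℝ) : ℂ)) atTop (𝓝 ((∫ x, g x : ℝ) : ℂ)) :=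
    (Complex.continuous_ofReal.tendsto _).comp hRlim
  have hT : Tendsto (fun k => ((κ k * R k : ℝ) : ℂ)) atTop (𝓝 (S₁ 1 F)) := by
    have hF' : IsOffDiagonal F := by
      rintro x ⟨i, j, hij, -⟩
      exact absurd (Subsingleton.elim i j) hij
    have h := htie 1 one_ne_zero (fun _ => g) F hF hF'
    refine h.congr fun k => ?_
    rw [latticeSchwinger_one_eq]
  have hne : ((∫ x, g x : ℝ) : ℂ) ≠ 0 := by exact_mod_cast hg
  have hRne : ∀ᶠ k in atTop, ((R k : ℝ) : ℂ) ≠ 0 := hRlimC.eventually_ne hne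
  have hκlim : Tendsto (fun k => ((κ k : ℝ) : ℂ)) atTop (𝓝 (S₁ 1 F / ((∫ x, g x : ℝ) : ℂ))) := by
    refine (hT.div hRlimC hne).congr' ?_
    filter_upwards [hRne] with k hk
    simp only [Pi.div_apply]
    push_cast
    exact mul_div_cancel_right₀ _ hk
  refine ⟨‖S₁ 1 F / ((∫ x, g x : ℝ) : ℂ)‖ + 1, ?_⟩
  have hle := hκlim.norm.eventually_le_const (lt_add_one _)
  filter_upwards [hle] with k hk
  have : ‖((κ k : ℝ) : ℂ)‖ = |κ k| := Complex.norm_real _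
  rw [← this]
  exact hk

/-! ## T for bounded multiplicative renormalisation -/

/-- **True densities are bounded when `|c_k| ≤ B` and `|κ_k| ≤ K`**: `|c_kⁿ W_k(x)| ≤ (2 B M + K)ⁿ` for `|F| ≤ M`. -/
theorem abs_trueDensity_le (r : LatticeRep G) (sch : SpeciesScheme (YMSpecies G)) {B K M : ℝ}
    (hM : ∀ U, |r.curvature.F U| ≤ M) (k : ℕ) (hc : |sch.c r.curvature k| ≤ B)
    (hκ : |sch.c r.curvature k *
      (wilsonTorusMean r.ρ (sch.β k) (sch.L k) r.curvature.F - sch.m r.curvature k)| ≤ K)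
    {n : ℕ} (x : Fin n → Site 4) :
    |(sch.c r.curvature k) ^ n * torusMoment r.ρ (sch.β k) (sch.L k) r.curvature.F (sch.m r.curvature k) x| ≤
      (2 * B * M + K) ^ n := by
  have hM0 : 0 ≤ M := (abs_nonneg _).trans (hM fun _ => 1)
  have hB : 0 ≤ B := (abs_nonneg _).trans hc
  set c := sch.c r.curvature k
  set e := wilsonTorusMean r.ρ (sch.β k) (sch.L k) r.curvature.F
  set m := sch.m r.curvature k
  have he : |e| ≤ M := abs_wilsonTorusMean_le r (sch.β k) (sch.L k) r.curvature hM
  -- `|c| · |m| ≤ B M + K`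
  have hcm : |c| * |m| ≤ B * M + K := by
    have h1 : |c| * |m| = |c * e - c * (e - m)| := by rw [← abs_mul]; ring_nf
    rw [h1]
    calc |c * e - c * (e - m)| ≤ |c * e| + |c * (e - m)| := abs_sub _ _
      _ ≤ B * M + K := add_le_add (by rw [abs_mul]; exact mul_le_mul hc he (abs_nonneg _) hB) hκ
  rw [abs_mul, abs_pow]
  calc |c| ^ n * |torusMoment r.ρ (sch.β k) (sch.L k) r.curvature.F m x|
      ≤ |c| ^ n * (M + |m|) ^ n :=
        mul_le_mul_of_nonneg_left (abs_torusMoment_le_pow r _ _ r.curvature hM m x) (pow_nonneg (abs_nonneg _) _)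
    _ = (|c| * M + |c| * |m|) ^ n := by rw [← mul_pow, mul_add]
    _ ≤ (2 * B * M + K) ^ n := by
        refine pow_le_pow_left₀ (by positivity) ?_ n
        have : |c| * M ≤ B * M := mul_le_mul_of_nonneg_right hc hM0
        linarith

/-- **T FOR BOUNDED MULTIPLICATIVE RENORMALISATION (the item `TemperedCurvatureMoments` with one extra hypothesis).**
For every compact simple `G`, `r`, `sch`, `S₁` with `W1 r sch S₁` (only the tie is used), the eight frames and the
cone (idle), IF the multiplicative renormalisation of the curvature species is bounded along the scheme,
`|c_k| ≤ B` for all `k`, then for every degree `n ≥ 1` the true densities `D_k = c_kⁿ W_k` are bounded by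
`(2 B M + K)ⁿ` for `k ≥ k₁` (`M` a bound of the Wilson action density; `K` a bound of the renormalised mean
`κ_k = c_k(⟨F⟩_k − m_k)`, which the degree-one tie keeps bounded — the additive counterterms need no hypothesis),
hence tempered with `N = 0`, and their Riemann sums converge to `S₁ n` on off-diagonal real tensors by the tie:
the conclusion of T verbatim.  The content of the item T is therefore entirely in the regime of unbounded
multiplicative renormalisation (`|c_k| → ∞` along a subsequence — the physical one, `c_k ≍ a_k⁻⁴` for `tr F²`). -/
theorem temperedCurvatureMoments_of_bddRenormalisation :
    ∀ (G : Type) [Group G] [TopologicalSpace G] [IsTopologicalGroup G] [CompactSpace G]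
      [MeasurableSpace G] [BorelSpace G], IsCompactSimpleLieGroup G →
      ∀ (r : LatticeRep G) (sch : SpeciesScheme (YMSpecies G)) (S₁ : SchwingerFamily E4),
        W1 r sch S₁ → EightFrameRP S₁ → PlanarCone S₁ →
        (∃ B : ℝ, ∀ k : ℕ, |sch.c r.curvature k| ≤ B) →
        ∀ n : ℕ, 0 < n → ∃ (D : ℕ → (Fin n → Site 4) → ℝ) (C : ℝ) (N k₀ : ℕ), 0 < C ∧
          (∀ k : ℕ, k₀ ≤ k → ∀ x : Fin n → Site 4, (∀ i, x i ∈ box 4 (sch.L k)) → Function.Injective x →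
            |D k x| ≤ C * (1 + ‖fun i => sch.a k • siteToE (x i)‖) ^ N *
              (1 + ∑ i, ∑ j ∈ Finset.univ.erase i,
                ‖sch.a k • siteToE (x i) - sch.a k • siteToE (x j)‖⁻¹) ^ N) ∧
          ∀ (f : Fin n → SchwartzMap E4 ℝ) (F : SchwartzMap (Fin n → E4) ℂ),
            IsTensorOf F (fun i => ofRealTest (f i)) → IsOffDiagonal F →
            Filter.Tendsto (fun k => (((sch.a k ^ 4) ^ n *
              ∑ x ∈ Fintype.piFinset (fun _ : Fin n => box 4 (sch.L k)),
                (∏ i, f i (sch.a k • siteToE (x i))) * D k x : ℝ) : ℂ)) Filter.atTop (nhds (S₁ n F)) := by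
  intro G _ _ _ _ _ _ _ r sch S₁ hW _ _ hB n hn
  obtain ⟨B, hB⟩ := hB
  obtain ⟨M, hM⟩ := r.curvature.bounded
  obtain ⟨K, hK⟩ := eventually_abs_renormalisedMean_le r sch S₁ hW.1
  obtain ⟨k₁, hk₁⟩ := eventually_atTop.1 hK
  have hM0 : 0 ≤ M := (abs_nonneg _).trans (hM fun _ => 1)
  have hB0 : 0 ≤ B := (abs_nonneg _).trans (hB 0)
  have hK0 : 0 ≤ K := (abs_nonneg _).trans (hk₁ k₁ le_rfl)
  refine temperedCurvatureMoments_of_trueDensity_tempered r sch S₁ hW.1 hn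
    ⟨(2 * B * M + K) ^ n + 1, 0, k₁, by positivity, fun k hk x _ _ => ?_⟩
  calc |(sch.c r.curvature k) ^ n * torusMoment r.ρ (sch.β k) (sch.L k) r.curvature.F (sch.m r.curvature k) x|
      ≤ (2 * B * M + K) ^ n := abs_trueDensity_le r sch hM k (hB k) (hk₁ k hk) x
    _ ≤ ((2 * B * M + K) ^ n + 1) * (1 + ‖fun i => sch.a k • siteToE (x i)‖) ^ (0 : ℕ) *
          (1 + ∑ i, ∑ j ∈ Finset.univ.erase i,
            ‖sch.a k • siteToE (x i) - sch.a k • siteToE (x j)‖⁻¹) ^ (0 : ℕ) := by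
        simp

end Summit.QuantumFields.YangMills.Theorems.SoftKernelBoostCovariance.Sketch

end
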